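import Summits.FinalStateConjecture.FinalStateConjecture.Theorems.EIHFluxBalanceInertialRecessionVirialIdentity

/-!
# Route EIHFluxBalance — crux `InertialRecession`, abstract endgame for general `N`:
# preparations for LEMMA C (i) — antitone envelopes of null functions; the Tauberian step in block form

Helper file for the crux `stmt-FinalStateConjecture-10166` (virial route; `InertialRecession_seat0_session8_note.md` §A).
Mathlib-only:

* `exists_antitone_envelope` — a function tending to `0` is dominated on `[t/2, ∞)` by an antitone function of `t` tending to `0`
  (this turns the rate-free errors `ζ`, `e = ξ̇ − v`, `r_min^{-1/2}` into integrable, monotone error RATES);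
* `tauberian_nonpos_of_virial_junk'` — the Tauberian end of LEMMA C in the form the block-assembled virial inequality delivers it:
  along the arithmetic sequences `T + n h(T)` and with a junk term `C_J (1 + D)` at the far end (registered one-line form unprimed).
-/

noncomputable section

open Finset Filter Topology MeasureTheory intervalIntegral Set

namespace Summit.FinalStateConjecture.FinalStateConjecture.Theorems.SublinearIsFree.Virial

open Literature.Geometry.Lorentzian

/-! ### Antitone envelopes of null functions -/

/-- **Antitone envelope.** If `f → 0` then there is an antitone `F ≥ 0` with `F → 0` and `f s ≤ F t` whenever `s ≥ t/2`, for all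
late `t`. (`F t = sup_{s ≥ max(t/2, T₁)} max(f s, 0)` where `f ≤ 1` after `T₁`.) [folklore] -/
theorem exists_antitone_envelope {f : ℝ → ℝ} (hf : Tendsto f atTop (𝓝 0)) :
    ∃ F : ℝ → ℝ, Antitone F ∧ Tendsto F atTop (𝓝 0) ∧ (∀ t, 0 ≤ F t) ∧
      ∃ T₀ : ℝ, ∀ t, T₀ ≤ t → ∀ s, t / 2 ≤ s → f s ≤ F t := by
  obtain ⟨T₁, hT₁⟩ := (hf.eventually (gt_mem_nhds (by norm_num : (0 : ℝ) < 1))).exists_forall_of_atTop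
  set g : ℝ → ℝ := fun s ↦ max (f s) 0 with hg
  set F : ℝ → ℝ := fun t ↦ sSup (g '' Ici (max (t / 2) T₁)) with hF
  have hne : ∀ t, (g '' Ici (max (t / 2) T₁)).Nonempty := fun t ↦ ⟨g (max (t / 2) T₁), Set.mem_image_of_mem _ self_mem_Ici⟩
  have hbdd : ∀ t, BddAbove (g '' Ici (max (t / 2) T₁)) := by
    intro t
    refine ⟨1, ?_⟩
    rintro _ ⟨s, hs, rfl⟩
    rw [hg]
    exact max_le (hT₁ s ((le_max_right _ _).trans hs)).le zero_le_one
  have hg0 : ∀ s, 0 ≤ g s := fun s ↦ le_max_right _ _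
  refine ⟨F, ?_, ?_, ?_, 2 * T₁, ?_⟩
  · intro t t' htt'
    have hsub : Ici (max (t' / 2) T₁) ⊆ Ici (max (t / 2) T₁) :=
      Ici_subset_Ici.mpr (max_le_max (by linarith) le_rfl)
    exact csSup_le_csSup (hbdd t) (hne t') (Set.image_mono hsub)
  · rw [Metric.tendsto_atTop]
    intro ε hε
    obtain ⟨T₂, hT₂⟩ := (hf.eventually (gt_mem_nhds (half_pos hε))).exists_forall_of_atTop
    refine ⟨2 * T₂, fun t ht ↦ ?_⟩
    have hFle : F t ≤ ε / 2 := by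
      refine csSup_le (hne t) ?_
      rintro _ ⟨s, hs, rfl⟩
      have hs' : T₂ ≤ s := by
        have : t / 2 ≤ s := (le_max_left _ _).trans hs
        linarith
      exact max_le (hT₂ s hs').le (half_pos hε).le
    have hF0 : 0 ≤ F t := (hg0 _).trans (le_csSup (hbdd t) (Set.mem_image_of_mem _ self_mem_Ici))
    rw [Real.dist_eq, sub_zero, abs_of_nonneg hF0]
    linarith
  · intro t
    exact (hg0 _).trans (le_csSup (hbdd t) (Set.mem_image_of_mem _ self_mem_Ici))
  · intro t ht s hs
    have hsmem : s ∈ Ici (max (t / 2) T₁) := max_le hs (by linarith)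
    exact (le_max_left _ _).trans (le_csSup (hbdd t) (Set.mem_image_of_mem _ hsmem))

/-! ### The Tauberian step, block form -/

/-- **Tauberian step of LEMMA C (junk form).** As `tauberian_nonpos_of_virial'`, but the virial inequality is only asked from each
late `T` along an arithmetic sequence `T + n h` (`h = h(T) > 0`) and with a junk term `C_J (1 + D(T + n h))` on the right: if `|G| ≤ D = o(t)`, `c∫σ₂ − ∫ε − C_J(1 + D(T′)) ≤ G T′ − G T` for those `T′`, `ε → 0`, `K ≤ Cσ₂`, `K → Kinf`, then `Kinf ≤ 0`. [folklore] -/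
theorem tauberian_nonpos_of_virial_junk' {G D σ₂ ε K : ℝ → ℝ} {c C CJ Kinf T₀ : ℝ} (hc : 0 < c) (hC : 0 < C) (hCJ : 0 ≤ CJ)
    (hG : ∀ t, T₀ ≤ t → |G t| ≤ D t)
    (hD : ∀ η : ℝ, 0 < η → ∀ᶠ t in atTop, D t ≤ η * t)
    (hσi : ∀ a b, IntervalIntegrable σ₂ volume a b) (hεi : ∀ a b, IntervalIntegrable ε volume a b)
    (hε : Tendsto ε atTop (𝓝 0))
    (hvir : ∀ T, T₀ ≤ T → ∃ h : ℝ, 0 < h ∧ ∀ n : ℕ,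
      c * (∫ t in T..(T + n * h), σ₂ t) - (∫ t in T..(T + n * h), ε t) - CJ * (1 + D (T + n * h)) ≤ G (T + n * h) - G T)
    (hKσ : ∀ t, T₀ ≤ t → K t ≤ C * σ₂ t) (hK : Tendsto K atTop (𝓝 Kinf)) : Kinf ≤ 0 := by
  by_contra hpos
  rw [not_le] at hpos
  have hK2 : ∀ᶠ t in atTop, Kinf / 2 ≤ K t := hK.eventually (Ici_mem_nhds (by linarith : Kinf / 2 < Kinf))
  have hε8 : ∀ᶠ t in atTop, |ε t| ≤ c * Kinf / (8 * C) := by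
    have hpos' : 0 < c * Kinf / (8 * C) := by positivity
    obtain ⟨T, hT⟩ := (Metric.tendsto_atTop.mp hε) (c * Kinf / (8 * C)) hpos'
    filter_upwards [eventually_ge_atTop T] with t ht
    have := hT t ht
    rw [Real.dist_eq, sub_zero] at this
    exact this.le
  set η : ℝ := c * Kinf / (16 * C * (1 + CJ)) with hη
  have hηpos : 0 < η := by positivity
  obtain ⟨T₁, hT₁⟩ :=
    ((((hK2.and hε8).and (hD η hηpos)).and (eventually_ge_atTop T₀)).and (eventually_ge_atTop 0)).exists_forall_of_atTop
  have hT₀ : T₀ ≤ T₁ := (hT₁ T₁ le_rfl).1.2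
  have hT₁0 : 0 ≤ T₁ := (hT₁ T₁ le_rfl).2
  obtain ⟨h, hh, hvir₁⟩ := hvir T₁ hT₀
  -- lower bound along the sequence
  have hlow : ∀ n : ℕ, 3 * c * Kinf / (8 * C) * (n * h) - CJ * (1 + D (T₁ + n * h)) ≤ G (T₁ + n * h) - G T₁ := by
    intro n
    have hv := hvir₁ n
    have hT' : T₁ ≤ T₁ + n * h := le_add_of_nonneg_right (by positivity)
    have hσ : Kinf / (2 * C) * (n * h) ≤ ∫ t in T₁..(T₁ + n * h), σ₂ t := by
      have hconst : ∫ t in T₁..(T₁ + n * h), Kinf / (2 * C) = Kinf / (2 * C) * (n * h) := by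
        rw [intervalIntegral.integral_const, smul_eq_mul]; ring
      rw [← hconst]
      refine intervalIntegral.integral_mono_on hT' intervalIntegrable_const (hσi _ _) fun t ht ↦ ?_
      have h1 := (hT₁ t ht.1).1.1.1.1
      have h2 := hKσ t (hT₀.trans ht.1)
      rw [div_le_iff₀ (by positivity)]
      nlinarith
    have hεb : ∫ t in T₁..(T₁ + n * h), ε t ≤ c * Kinf / (8 * C) * (n * h) := by
      have hconst : ∫ t in T₁..(T₁ + n * h), c * Kinf / (8 * C) = c * Kinf / (8 * C) * (n * h) := by
        rw [intervalIntegral.integral_const, smul_eq_mul]; ring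
      rw [← hconst]
      refine intervalIntegral.integral_mono_on hT' (hεi _ _) intervalIntegrable_const fun t ht ↦ ?_
      exact (le_abs_self _).trans (hT₁ t ht.1).1.1.1.2
    have hcσ := mul_le_mul_of_nonneg_left hσ hc.le
    have : 3 * c * Kinf / (8 * C) * (n * h) = c * (Kinf / (2 * C) * (n * h)) - c * Kinf / (8 * C) * (n * h) := by ring
    linarith
  -- upper bound from `|G| ≤ D ≤ ηt`
  have hup : ∀ n : ℕ, G (T₁ + n * h) - G T₁ ≤ η * (T₁ + n * h) + D T₁ := by
    intro n
    have hT' : T₁ ≤ T₁ + n * h := le_add_of_nonneg_right (by positivity)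
    have h1 := hT₁ _ hT'
    have hGT' : |G (T₁ + n * h)| ≤ D (T₁ + n * h) := hG _ h1.1.2
    have hDT' : D (T₁ + n * h) ≤ η * (T₁ + n * h) := h1.1.1.2
    have hGT₁ : |G T₁| ≤ D T₁ := hG T₁ hT₀
    linarith [le_abs_self (G (T₁ + n * h)), neg_abs_le (G T₁)]
  have hDup : ∀ n : ℕ, D (T₁ + n * h) ≤ η * (T₁ + n * h) := fun n ↦
    (hT₁ _ (le_add_of_nonneg_right (by positivity))).1.1.2
  -- choose `n` large
  have hD0 : 0 ≤ D T₁ := (abs_nonneg _).trans (hG T₁ hT₀)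
  set A : ℝ := c * Kinf / (16 * C) with hA
  have hApos : 0 < A := by positivity
  -- target length `L` with `6 A L ≥ (everything else)`; everything else grows like `2A·L` plus constants
  set L₀ : ℝ := (2 * A * T₁ + D T₁ + CJ + 1) / A with hL₀
  have hL₀pos : 0 < L₀ := by rw [hL₀]; positivity
  obtain ⟨n, hn⟩ := exists_nat_ge (L₀ / h)
  have hnh : L₀ ≤ n * h := by rwa [div_le_iff₀ hh] at hn
  have h1 := hlow n
  have h2 := hup n
  have h3 := hDup n
  -- `η (1 + CJ) = A`
  have hηA : η * (1 + CJ) = A := by rw [hη, hA]; field_simp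
  have hkey : 6 * A * (n * h) - CJ * (1 + D (T₁ + n * h)) ≤ η * (T₁ + n * h) + D T₁ := by
    have : 3 * c * Kinf / (8 * C) = 6 * A := by rw [hA]; ring
    rw [this] at h1
    linarith
  have hkey2 : 6 * A * (n * h) ≤ η * (1 + CJ) * (T₁ + n * h) + D T₁ + CJ := by
    have hCJD : CJ * D (T₁ + n * h) ≤ CJ * (η * (T₁ + n * h)) := mul_le_mul_of_nonneg_left h3 hCJ
    nlinarith
  rw [hηA] at hkey2
  -- `6 A L ≤ A T₁ + A L + D T₁ + CJ` with `L ≥ L₀ = (2 A T₁ + D T₁ + CJ + 1)/A`: contradiction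
  have hAL : A * L₀ = 2 * A * T₁ + D T₁ + CJ + 1 := by rw [hL₀]; field_simp
  have hAnh : A * L₀ ≤ A * (n * h) := mul_le_mul_of_nonneg_left hnh hApos.le
  nlinarith

/-- Registered one-line form of `tauberian_nonpos_of_virial_junk'`. [folklore] -/
theorem tauberian_nonpos_of_virial_junk : open MeasureTheory Filter Topology intervalIntegral in ∀ {G D σ₂ ε K : ℝ → ℝ} {c C CJ Kinf T₀ : ℝ}, 0 < c → 0 < C → 0 ≤ CJ → (∀ t, T₀ ≤ t → |G t| ≤ D t) → (∀ η : ℝ, 0 < η → ∀ᶠ t in atTop, D t ≤ η * t) → (∀ a b, IntervalIntegrable σ₂ volume a b) → (∀ a b, IntervalIntegrable ε volume a b) → Tendsto ε atTop (𝓝 0) → (∀ T, T₀ ≤ T → ∃ h : ℝ, 0 < h ∧ ∀ n : ℕ, c * (∫ t in T..(T + n * h), σ₂ t) - (∫ t in T..(T + n * h), ε t) - CJ * (1 + D (T + n * h)) ≤ G (T + n * h) - G T) → (∀ t, T₀ ≤ t → K t ≤ C * σ₂ t) → Tendsto K atTop (𝓝 Kinf) → Kinf ≤ 0 :=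
  fun hc hC hCJ hG hD hσi hεi hε hvir hKσ hK ↦ tauberian_nonpos_of_virial_junk' hc hC hCJ hG hD hσi hεi hε hvir hKσ hK

end Summit.FinalStateConjecture.FinalStateConjecture.Theorems.SublinearIsFree.Virial

end
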